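/- Copyright: the b2b-balaban cell (near-miss cell 7), T⁴-continuum fan-out, lineage t4-ne7b-p1 (node U5c COUNT
member).  Released under the licence of the surrounding project. -/
import Summits.QuantumFields.BalabanUV.T4Continuum.Support.HistoryTouchComponents
import Summits.QuantumFields.BalabanUV.T4Continuum.Support.HistoryGenealogyRealiseR

/-!
# INSTANTIATION FROM THE LEVEL SETS, part 1 (H3-(ID), geometric half, M3b-2 brick 3): print's construction of the
large-field components, level by level, written as a DEFINITION over (flow, new regions, new-field cubes), and the
component bookkeeping `ComponentHistory` it EXTRACTS — with `WF` PROVED (owner module of row NE7b, lineage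
`t4-ne7b-p1` gen 40, ruling R-OWNER-40-4; re-open object (α), `SCOPE-alpha.md` v2.2 §5 row M3b-2 — PRE-POSITIONING ONLY)

Summits-side support leaf of the T⁴-continuum cell (rung (B)+1 on a FINITE torus only; NOT infinite volume, NOT the
mass gap, NOT the Clay statement; NOT a proof of the spine estimate NE7b, which is the cell's OWN estimate, NOT PRINTED
and NOT PROVED).  [folklore] finite combinatorics in the ℤᵈ index model over brick 2 `HistoryTouchComponents`
(`tcomps`, `fam_disjoint_of_ne`, `exists_chainTouch_enum_of_mem_tcomps`), row S13∕S13-R (`ComponentHistory`, `WF`,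
`lefts`∕`rights`), row S14 (`Lab`, `imgC`, `ChainTouch`), row S1b (`Stops`), b02 (`Sop`, `ratio`, `fam`); nothing
printed is asserted, no `def … : Prop` fact of Bałaban's, no cite-tagged hypothesis, zero `sorry`.  B16 =
[Balaban1989LargeFieldII] pp. 383–387 and B15 = [Balaban1989LargeFieldI] p. 177 are manuscripts UNDER AUDIT; the
construction below is OUR READING of their rules turned into a definition (locators in the field docstrings, C-B16-6);
that Bałaban's regions ARE this process's output is the residual reading the junction M2∕M4 must display.

THE CONSTRUCTION (`RunInput.St`).  A LINE is (current domain `D`, last event step `t`, last-event domain `E`).  From the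
lines live at level `ℓ − 1` and the input of level `ℓ`: a line is READY iff its orbit `Stops` at `ℓ − 1 − t` (conditions
(i)∕(ii), B15 p. 177, memory `R t`); it has a NEW FIELD iff its domain meets the new-field cubes `F (ℓ−1)` of the
preparatory operations; the 𝐑-operation INTEGRATES the ready lines without new field (they die) and RENEWS the ready
lines with one (B16 p. 385 bottom – p. 386 l. 3); the ALIVE lines (unready, or renewed) enter level `ℓ` through ONE
S-operation of their domain («Z = S(Z₀)», (1.83)), together with the NEW REGIONS `N ℓ` ((1.76)); the COMPONENTS of
level `ℓ` are the touch-components (brick 2) of the family «images of alive lines ∪ new regions» (p. 386: «a pair of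
domains is a line in G if … the corresponding domains intersect, or touch each other»); a component's domain is the
union of its block's images ((1.84)); its (t, E) are inherited iff the block is a lone UNRENEWED old line, else
`(ℓ, domain)` (an event: birth, renewal, join).

WHAT IS DEFINED AND PROVED.  `Line`, `RunInput` (+ the displayed input condition `NewOK`: every new region anchored,
face-connected, class `≥ treeLen` — print's (1.79)∕p. 381 facts, T-class), `lab`, `Rdy`∕`Fld`∕`Alive`∕`Rnw`, `P`
(images), `vert`, `blocks`, `loneOld`, `newLine`, `form`, **`St`**, `Prev`, `enumB` (a chosen leaf-first enumeration per
block), **`hist : ComponentHistory (Lab d)`** (comp = labels of live lines; constit = the block's enumeration, labels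
`(0, domain)`; newReg = `N`), **`rnw`** (per-part renewal flags), `domL _ p = p.2`; lemmas `St_eq_form`, `mem_St_iff`,
`lab_newLine`, `P_eq_imgC`, **`St_nonempty_disjoint`** (every live domain nonempty; distinct live lines have DISJOINT
domains — by induction: distinct blocks have disjoint unions), `newLine_injOn`, `lab_injOn_St`, `constit_lab_newLine`,
`constit_eq_nil`, `mem_comp_iff`, `enumB_spec`.  Sibling `…InstantiateWF`: `wf_hist : (I.hist).WF`; brick 4
(`…InstantiateClauses`): the clauses `LevelClausesR` and the realisation of every component's pedigree.

HONEST.  Proves nothing of Bałaban's; NE7b NOT proved; spine 0∕9.  HONEST DEPENDENCY (cell): continuum YM on T⁴ ⇐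
BetaPertH ∧ nine spine estimates (0/9 proved); BetaPertH ⇐ (D1) ∧ (D4) ∧ CAP+tail; G-an2-4 gates asym, D1 and NE2/3/4.
This file changes none of it. -/

open Finset
open Literature.MathematicalPhysics.QuantumFieldTheory.Balaban1983to89
open Literature.MathematicalPhysics.QuantumFieldTheory.Balaban1983to89.B13ScaleTransfer
open Literature.MathematicalPhysics.QuantumFieldTheory.Balaban1983to89.TreeLength
open Literature.MathematicalPhysics.QuantumFieldTheory.Balaban1983to89.B16SProfile
open Literature.MathematicalPhysics.QuantumFieldTheory.Balaban1983to89.B16MergeGeometry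
open Summit.QuantumFields.BalabanUV.T4Continuum.HistoryRealise
open Summit.QuantumFields.BalabanUV.T4Continuum.HistoryGenealogyExtraction
open Summit.QuantumFields.BalabanUV.T4Continuum.HistoryGenealogyRealise
open Summit.QuantumFields.BalabanUV.T4Continuum.HistoryTouchComponents

namespace Summit.QuantumFields.BalabanUV.T4Continuum.HistoryGenealogyInstantiate

noncomputable section

open Classical

variable {d : ℕ}

/-! ## §1 Lines, input, and the level step -/

/-- **A LINE**: a pending component's current domain `D`, the step `t` of its last event and its domain `E` then.
[folklore] -/
structure Line (d : ℕ) where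
  /-- current domain (cube indices at the current scale) -/
  D : Finset (Pt d)
  /-- step of the last event (birth, renewal, join) -/
  t : ℕ
  /-- domain at the last event -/
  E : Finset (Pt d)

/-- the LABEL of a line in the extracted bookkeeping: `(0, current domain)` [folklore] -/
def lab (τ : Line d) : Lab d := ((fun _ => 0 : Pt d), τ.D)

/-- the label carries the domain [folklore] -/
@[simp] theorem lab_snd (τ : Line d) : (lab τ).2 = τ.D := rfl

/-- labels of lines with equal domains are equal, and conversely [folklore] -/
theorem lab_eq_iff {τ τ' : Line d} : lab τ = lab τ' ↔ τ.D = τ'.D := by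
  simp [lab, Prod.ext_iff]

/-- vertices ↦ labelled vertices (`Sum.map lab id`) [folklore] -/
def toLab : Line d ⊕ Lab d → Lab d ⊕ Lab d := Sum.map lab id

/-- **THE INPUT OF A RUN**: flow (`L`, exponents `s`, sizes `R`), the new large-field regions `N ℓ` created at level
`ℓ` with their classes `cls` ((1.76), (1.79)), and the NEW-FIELD cubes `F j` of the preparatory operations of the
𝐑-operation acting on the level-`j` density (the renewal trigger, B16 p. 385 bottom). [folklore] -/
structure RunInput (d : ℕ) where
  /-- blocking parameter -/
  L : ℕ
  /-- size exponents of the flow -/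
  s : ℕ → ℕ
  /-- sizes `R_j` (memory of condition (ii)) -/
  R : ℕ → ℕ
  /-- new large-field regions of level `ℓ`, labelled (anchor, region) -/
  N : ℕ → Finset (Lab d)
  /-- class `d′` of a region -/
  cls : Lab d → ℕ
  /-- new-field cubes of the preparatory operations at level `j` -/
  F : ℕ → Finset (Pt d)

namespace RunInput

variable (I : RunInput d)

/-- the DISPLAYED input condition (G-new): every new region has its anchor inside, is face-connected, and has class
`≥ treeLen` (print's statements about new large-field regions, p. 381∕383 — T-class, never asserted) [folklore] -/
structure NewOK : Prop where
  /-- anchored, face-connected, class at least the tree length -/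
  ok : ∀ ℓ, ∀ n ∈ I.N ℓ, n.1 ∈ n.2 ∧ FaceConnected n.2 ∧ treeLen n.2 ≤ I.cls n

/-- READY at level `j`: the orbit of the last-event domain stops at the relative index `j − t` [folklore] -/
def Rdy (j : ℕ) (τ : Line d) : Prop := Stops I.L I.s I.R τ.t τ.E (j - τ.t)

/-- a NEW FIELD inside at level `j` [folklore] -/
def Fld (j : ℕ) (τ : Line d) : Prop := (τ.D ∩ I.F j).Nonempty

/-- ALIVE after the 𝐑-operation of level `j`: unready, or with a new field (the ready clean ones are integrated)
[folklore] -/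
def Alive (j : ℕ) (τ : Line d) : Prop := ¬ I.Rdy j τ ∨ I.Fld j τ

/-- RENEWED by the 𝐑-operation of level `j`: ready with a new field [folklore] -/
def Rnw (j : ℕ) (τ : Line d) : Prop := I.Rdy j τ ∧ I.Fld j τ

/-- a renewed line is alive [folklore] -/
theorem alive_of_rnw {j : ℕ} {τ : Line d} (h : I.Rnw j τ) : I.Alive j τ := Or.inr h.2

/-- an alive unrenewed line is unready [folklore] -/
theorem not_rdy_of_alive_not_rnw {j : ℕ} {τ : Line d} (ha : I.Alive j τ) (hr : ¬ I.Rnw j τ) : ¬ I.Rdy j τ :=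
  fun hR => ha.elim (fun h => h hR) fun hF => hr ⟨hR, hF⟩

/-- the IMAGES of the vertices at the level `ℓ` being formed: an old line enters through one S-operation of its domain
(ratio of level `ℓ − 1`), a new region as itself [folklore] -/
def P (ℓ : ℕ) : Line d ⊕ Lab d → Finset (Pt d) := Sum.elim (fun τ => Sop (ratio I.L I.s (ℓ - 1)) τ.D) fun n => n.2

/-- the `dom` function of the extracted bookkeeping: the label carries the domain [folklore] -/
def domL : ℕ → Lab d → Finset (Pt d) := fun _ p => p.2

/-- the images are row S14's `imgC` on the labelled vertices [folklore] -/
theorem P_eq_imgC (ℓ : ℕ) (x : Line d ⊕ Lab d) : I.P ℓ x = imgC I.L I.s domL ℓ (toLab x) := by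
  cases x <;> rfl

/-- the VERTICES at level `ℓ`: the alive lines of the previous level and the new regions of level `ℓ` [folklore] -/
def vert (ℓ : ℕ) (prev : Finset (Line d)) : Finset (Line d ⊕ Lab d) :=
  (prev.filter (I.Alive (ℓ - 1))).image Sum.inl ∪ (I.N ℓ).image Sum.inr

/-- membership of an old vertex [folklore] -/
theorem inl_mem_vert {ℓ : ℕ} {prev : Finset (Line d)} {τ : Line d} :
    Sum.inl τ ∈ I.vert ℓ prev ↔ τ ∈ prev ∧ I.Alive (ℓ - 1) τ := by
  simp [vert]

/-- membership of a new vertex [folklore] -/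
theorem inr_mem_vert {ℓ : ℕ} {prev : Finset (Line d)} {n : Lab d} : Sum.inr n ∈ I.vert ℓ prev ↔ n ∈ I.N ℓ := by
  simp [vert]

/-- the BLOCKS (components) at level `ℓ` [folklore] -/
def blocks (ℓ : ℕ) (prev : Finset (Line d)) : Finset (Finset (Line d ⊕ Lab d)) := tcomps (I.P ℓ) (I.vert ℓ prev)

/-- the lone UNRENEWED old line of a block, if the block is one [folklore] -/
def loneOld (ℓ : ℕ) (T : Finset (Line d ⊕ Lab d)) : Option (Line d) :=
  if h : ∃ τ, T = {Sum.inl τ} ∧ ¬ I.Rnw (ℓ - 1) τ then some (Classical.choose h) else none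

/-- `loneOld` of a lone unrenewed old line [folklore] -/
theorem loneOld_singleton {ℓ : ℕ} {τ : Line d} (h : ¬ I.Rnw (ℓ - 1) τ) : I.loneOld ℓ {Sum.inl τ} = some τ := by
  have hex : ∃ τ', ({Sum.inl τ} : Finset (Line d ⊕ Lab d)) = {Sum.inl τ'} ∧ ¬ I.Rnw (ℓ - 1) τ' := ⟨τ, rfl, h⟩
  rw [loneOld, dif_pos hex]
  have hspec := (Classical.choose_spec hex).1
  have h1 : τ = Classical.choose hex := Sum.inl_injective (Finset.singleton_inj.1 hspec)
  rw [← h1]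

/-- `loneOld T = some τ` forces the block [folklore] -/
theorem eq_of_loneOld_eq_some {ℓ : ℕ} {T : Finset (Line d ⊕ Lab d)} {τ : Line d} (h : I.loneOld ℓ T = some τ) :
    T = {Sum.inl τ} ∧ ¬ I.Rnw (ℓ - 1) τ := by
  unfold loneOld at h
  split_ifs at h with hex
  rw [Option.some.injEq] at h
  subst h
  exact Classical.choose_spec hex

/-- **THE NEW LINE of a block**: domain = the union of the block's images; `(t, E)` inherited iff the block is a lone
unrenewed old line, else the event values `(ℓ, domain)`. [folklore] -/
def newLine (ℓ : ℕ) (T : Finset (Line d ⊕ Lab d)) : Line d :=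
  match I.loneOld ℓ T with
  | some τ => ⟨fam (I.P ℓ) T, τ.t, τ.E⟩
  | none => ⟨fam (I.P ℓ) T, ℓ, fam (I.P ℓ) T⟩

/-- the new line's domain is the union of the block's images [folklore] -/
@[simp] theorem newLine_D (ℓ : ℕ) (T : Finset (Line d ⊕ Lab d)) : (I.newLine ℓ T).D = fam (I.P ℓ) T := by
  unfold newLine; split <;> rfl

/-- its label [folklore] -/
theorem lab_newLine (ℓ : ℕ) (T : Finset (Line d ⊕ Lab d)) : lab (I.newLine ℓ T) = ((fun _ => 0 : Pt d), fam (I.P ℓ) T) := by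
  simp [lab]

/-- the lines FORMED at level `ℓ` from the previous lines [folklore] -/
def form (ℓ : ℕ) (prev : Finset (Line d)) : Finset (Line d) := (I.blocks ℓ prev).image (I.newLine ℓ)

/-- **THE LIVE LINES AT LEVEL `ℓ`** (the process). [folklore] -/
def St : ℕ → Finset (Line d)
  | 0 => I.form 0 ∅
  | ℓ + 1 => I.form (ℓ + 1) (St ℓ)

/-- the previous level's lines (none before level `0`) [folklore] -/
def Prev : ℕ → Finset (Line d)
  | 0 => ∅
  | ℓ + 1 => I.St ℓ

/-- the process equation, uniformly in `ℓ` [folklore] -/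
theorem St_eq_form (ℓ : ℕ) : I.St ℓ = I.form ℓ (I.Prev ℓ) := by
  cases ℓ <;> rfl

/-- membership in the live lines [folklore] -/
theorem mem_St_iff {ℓ : ℕ} {τ : Line d} : τ ∈ I.St ℓ ↔ ∃ T ∈ I.blocks ℓ (I.Prev ℓ), I.newLine ℓ T = τ := by
  rw [St_eq_form, form, Finset.mem_image]

/-- a CHOSEN leaf-first enumeration of a block (brick 2 + brick 1) [folklore] -/
def enumB (ℓ : ℕ) (prev : Finset (Line d)) (T : Finset (Line d ⊕ Lab d)) : List (Line d ⊕ Lab d) :=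
  if hT : T ∈ I.blocks ℓ prev then Classical.choose (exists_chainTouch_enum_of_mem_tcomps hT) else []

/-- its specification [folklore] -/
theorem enumB_spec {ℓ : ℕ} {prev : Finset (Line d)} {T : Finset (Line d ⊕ Lab d)} (hT : T ∈ I.blocks ℓ prev) :
    (I.enumB ℓ prev T).Nodup ∧ (∀ x, x ∈ I.enumB ℓ prev T ↔ x ∈ T) ∧ ChainTouch ((I.enumB ℓ prev T).map (I.P ℓ)) := by
  rw [enumB, dif_pos hT]
  obtain ⟨h1, h2, h3⟩ := Classical.choose_spec (exists_chainTouch_enum_of_mem_tcomps hT)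
  refine ⟨h1, fun x => ?_, h3⟩
  simpa only [List.mem_toFinset] using Finset.ext_iff.1 h2 x

/-- **THE EXTRACTED COMPONENT BOOKKEEPING**: components = labels of the live lines; constituents of a component = the
labelled enumeration of its block; new regions = `N`; classes = `cls`; the per-component flag `fieldIn` of row S13 is
NOT used (renewal is per part, `rnw`). [folklore] -/
def hist : ComponentHistory (Lab d) where
  comp ℓ := (I.St ℓ).image lab
  newReg := I.N
  cls := I.cls
  constit ℓ c :=
    if h : ∃ T ∈ I.blocks ℓ (I.Prev ℓ), lab (I.newLine ℓ T) = c then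
      (I.enumB ℓ (I.Prev ℓ) (Classical.choose h)).map toLab
    else []
  fieldIn _ _ := false

/-- **THE PER-PART RENEWAL FLAGS**: the line labelled `p` at level `j` is renewed by the 𝐑-operation of level `j`.
[folklore] -/
def rnw (j : ℕ) (p : Lab d) : Bool := decide (∃ τ ∈ I.St j, lab τ = p ∧ I.Rnw j τ)

/-! ## §2 Nonempty, pairwise disjoint live domains -/

/-- under `NewOK` every vertex image is nonempty, given nonempty previous domains [folklore] -/
theorem P_nonempty (hN : I.NewOK) {ℓ : ℕ} {prev : Finset (Line d)} (hprev : ∀ τ ∈ prev, τ.D.Nonempty) :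
    ∀ v ∈ I.vert ℓ prev, (I.P ℓ v).Nonempty := by
  intro v hv
  cases v with
  | inl τ => exact Sop_nonempty _ (hprev τ ((I.inl_mem_vert).1 hv).1)
  | inr n =>
      have hn := (I.inr_mem_vert).1 hv
      exact ⟨n.1, (hN.ok ℓ n hn).1⟩

/-- **LIVE DOMAINS ARE NONEMPTY AND PAIRWISE DISJOINT** (under `NewOK`). [folklore] -/
theorem St_nonempty_disjoint (hN : I.NewOK) : ∀ ℓ : ℕ,
    (∀ τ ∈ I.St ℓ, τ.D.Nonempty) ∧ (∀ τ ∈ I.St ℓ, ∀ τ' ∈ I.St ℓ, τ ≠ τ' → Disjoint τ.D τ'.D) := by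
  -- one step, from any previous family with nonempty domains
  have step : ∀ ℓ prev, (∀ τ ∈ prev, τ.D.Nonempty) →
      (∀ τ ∈ I.form ℓ prev, τ.D.Nonempty) ∧
        (∀ τ ∈ I.form ℓ prev, ∀ τ' ∈ I.form ℓ prev, τ ≠ τ' → Disjoint τ.D τ'.D) := by
    intro ℓ prev hprev
    have hPne := I.P_nonempty hN (ℓ := ℓ) hprev
    constructor
    · intro τ hτ
      obtain ⟨T, hT, rfl⟩ := Finset.mem_image.1 hτ
      rw [newLine_D]
      exact fam_nonempty_of_mem_tcomps hT hPne
    · intro τ hτ τ' hτ' hne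
      obtain ⟨T, hT, rfl⟩ := Finset.mem_image.1 hτ
      obtain ⟨T', hT', rfl⟩ := Finset.mem_image.1 hτ'
      have hTT : T ≠ T' := fun h => hne (by rw [h])
      rw [newLine_D, newLine_D]
      exact fam_disjoint_of_ne hT hT' hTT
  intro ℓ
  induction ℓ with
  | zero => rw [St_eq_form]; exact step 0 ∅ (by simp)
  | succ ℓ ih => rw [St_eq_form]; exact step (ℓ + 1) (I.St ℓ) ih.1

/-- every vertex image at level `ℓ` is nonempty (under `NewOK`) [folklore] -/
theorem P_nonempty_vert (hN : I.NewOK) (ℓ : ℕ) : ∀ v ∈ I.vert ℓ (I.Prev ℓ), (I.P ℓ v).Nonempty := by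
  refine I.P_nonempty hN fun τ hτ => ?_
  cases ℓ with
  | zero => simp [Prev] at hτ
  | succ ℓ => exact (I.St_nonempty_disjoint hN ℓ).1 τ hτ

/-- **`newLine` IS INJECTIVE ON THE BLOCKS** (distinct blocks have different unions). [folklore] -/
theorem newLine_injOn (hN : I.NewOK) (ℓ : ℕ) {T T' : Finset (Line d ⊕ Lab d)} (hT : T ∈ I.blocks ℓ (I.Prev ℓ))
    (hT' : T' ∈ I.blocks ℓ (I.Prev ℓ)) (h : lab (I.newLine ℓ T) = lab (I.newLine ℓ T')) : T = T' := by
  by_contra hne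
  rw [lab_eq_iff, newLine_D, newLine_D] at h
  exact fam_ne_of_ne hT hT' hne (I.P_nonempty_vert hN ℓ) h

/-- distinct live lines have distinct labels (under `NewOK`) [folklore] -/
theorem lab_injOn_St (hN : I.NewOK) (ℓ : ℕ) {τ τ' : Line d} (hτ : τ ∈ I.St ℓ) (hτ' : τ' ∈ I.St ℓ)
    (h : lab τ = lab τ') : τ = τ' := by
  by_contra hne
  obtain ⟨x, hx⟩ := (I.St_nonempty_disjoint hN ℓ).1 τ hτ
  rw [lab_eq_iff] at h
  exact Finset.disjoint_left.1 ((I.St_nonempty_disjoint hN ℓ).2 τ hτ τ' hτ' hne) hx (h ▸ hx)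

/-! ## §3 The constituent list of a component is the enumeration of its block -/

/-- **THE CONSTITUENTS OF THE COMPONENT OF A BLOCK** are the labelled leaf-first enumeration of that block
(under `NewOK`). [folklore] -/
theorem constit_lab_newLine (hN : I.NewOK) {ℓ : ℕ} {T : Finset (Line d ⊕ Lab d)} (hT : T ∈ I.blocks ℓ (I.Prev ℓ)) :
    I.hist.constit ℓ (lab (I.newLine ℓ T)) = (I.enumB ℓ (I.Prev ℓ) T).map toLab := by
  have hex : ∃ T' ∈ I.blocks ℓ (I.Prev ℓ), lab (I.newLine ℓ T') = lab (I.newLine ℓ T) := ⟨T, hT, rfl⟩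
  show (if h : ∃ T' ∈ I.blocks ℓ (I.Prev ℓ), lab (I.newLine ℓ T') = lab (I.newLine ℓ T) then
      (I.enumB ℓ (I.Prev ℓ) (Classical.choose h)).map toLab else []) = _
  rw [dif_pos hex]
  obtain ⟨hT', hlab⟩ := Classical.choose_spec hex
  rw [I.newLine_injOn hN ℓ hT' hT hlab]

/-- constituents of a non-component are empty [folklore] -/
theorem constit_eq_nil {ℓ : ℕ} {c : Lab d} (h : ¬ ∃ T ∈ I.blocks ℓ (I.Prev ℓ), lab (I.newLine ℓ T) = c) :
    I.hist.constit ℓ c = [] := by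
  show (if h : ∃ T ∈ I.blocks ℓ (I.Prev ℓ), lab (I.newLine ℓ T) = c then
      (I.enumB ℓ (I.Prev ℓ) (Classical.choose h)).map toLab else []) = []
  rw [dif_neg h]

/-- membership in the components of the extracted bookkeeping [folklore] -/
theorem mem_comp_iff {ℓ : ℕ} {c : Lab d} : c ∈ I.hist.comp ℓ ↔ ∃ T ∈ I.blocks ℓ (I.Prev ℓ), lab (I.newLine ℓ T) = c := by
  show c ∈ (I.St ℓ).image lab ↔ _
  simp only [Finset.mem_image, mem_St_iff]
  constructor
  · rintro ⟨τ, ⟨T, hT, rfl⟩, rfl⟩; exact ⟨T, hT, rfl⟩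
  · rintro ⟨T, hT, rfl⟩; exact ⟨I.newLine ℓ T, ⟨T, hT, rfl⟩, rfl⟩

end RunInput

end

end Summit.QuantumFields.BalabanUV.T4Continuum.HistoryGenealogyInstantiate
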